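import Literature.Probability.Percolation.SiteEmbDomainCrossing
import Literature.Probability.LatticeModels.ProdBernoulliThinning
import Literature.Probability.Percolation.UnionJack
import HarnessLib

/-!
# Flip pairing for the type-II pivotal mass — stub `stub_flipPairing` (C1) of line `registered`

Crux stmt-CriticalPhenomena-4559 `UnionJackBeffara.MixedInterpolation`, line `registered`
(skeleton `Cruxes/MixedInterpolation/Lines/birth.lean`, lead's reshape of cycle 1: the former stub C
`stub_labelFlipBalance` = C1 `stub_flipPairing` (this file, exact) + C2 `stub_oneMeasureLabelBalance`).
Beffara 2008 §5.2: the global colour flip maps `P_{1/2,q}` to `P_{1/2,1-q}`; on events it carries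
"`v` pivotal for `S`" to "`v` pivotal for the flip-dual event `{ω | ωᶜ ∉ S}`".  Hence the summand of
`M₂(1-q, R, δ)` is, EXACTLY, the `P_q`-probability that the type-II centre is pivotal for the flip-dual
of the crude crossing (no closed crossing from arc 0 to arc 2) — the comparison asked by stub C is a
comparison under ONE measure of pivotality for the crossing and for its dual ("how much
`P[v ∈ Piv(U_{Ω,A,B,C,D})]` depends on the location of `A, B, C, D`").
-/

noncomputable section

namespace Summit.CriticalPhenomena.CardyFormulaZ2.Cruxes.MixedInterpolation.Registered

open Set MeasureTheory
open Literature.Probability.LatticeModels Literature.Probability.Percolation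
open Literature.Barriers.CriticalPhenomena

/-- **Colour flip on the law** (Beffara 2008 §5.2 "flipping the state of all vertices"): the image of
`P_{1/2,q} = prodBernoulli (mixedParam q)` under complementation `ω ↦ ωᶜ` is `P_{1/2,1-q}`
(`prodBernoulli_map_compl` + `symm_mixedParam`). [cite: Beffara2008Universal, §5.2] -/
theorem flip_prodBernoulli_map_compl (q : unitInterval) :
    (prodBernoulli (mixedParam q)).map compl = prodBernoulli (mixedParam (unitInterval.symm q)) := by
  rw [prodBernoulli_map_compl]
  congr 1
  funext v
  exact symm_mixedParam q v

/-- Applied form: `P_{1-q}(S) = P_q({ω | ωᶜ ∈ S})` for every event `S` (complementation is a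
measurable involution, so no measurability of `S` is needed). [cite: Beffara2008Universal, §5.2] -/
theorem flip_prodBernoulli_real (q : unitInterval) (S : Set (Set MixedSite)) :
    (prodBernoulli (mixedParam (unitInterval.symm q))).real S =
      (prodBernoulli (mixedParam q)).real (compl ⁻¹' S) := by
  have e : (MeasurableEquiv.ofInvolutive compl compl_involutive
      (measurable_set_iff.2 fun i => (measurable_set_mem i).not) : Set MixedSite → Set MixedSite) = compl := rfl
  rw [measureReal_def, measureReal_def, ← flip_prodBernoulli_map_compl q, ← e, MeasurableEquiv.map_apply]

/-- The flip carries "`v` pivotal for `S`" (Beffara Def. 17: `S` holds with `v` opened and fails with `v`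
closed) to "`v` pivotal for the flip-dual event `{ω | ωᶜ ∉ S}`" . [cite: Beffara2008Universal, §5.2 Def. 17] -/
theorem compl_preimage_pivotal {V : Type*} (S : Set (Set V)) (v : V) :
    compl ⁻¹' {ω : Set V | insert v ω ∈ S ∧ ω \ {v} ∉ S} =
      {ω | insert v ω ∈ {ω' : Set V | ω'ᶜ ∉ S} ∧ ω \ {v} ∉ {ω' : Set V | ω'ᶜ ∉ S}} := by
  ext ω
  simp only [Set.mem_preimage, Set.mem_setOf_eq, not_not]
  have h1 : insert v ωᶜ = (ω \ {v})ᶜ := by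
    ext x; simp [or_iff_not_imp_left, and_comm]
  have h2 : ωᶜ \ {v} = (insert v ω)ᶜ := by
    ext x; simp [not_or, and_comm]
  rw [h1, h2]
  exact and_comm

/-- **Flip pairing (termwise, exact).** For every `q`, event `S` and site `v`: the `P_{1-q}`-probability
that `v` is pivotal for `S` equals the `P_q`-probability that `v` is pivotal for the flip-dual event
`{ω | ωᶜ ∉ S}`. For `S = cross_δ(R)` the flip-dual is "no closed `G_s`-crossing of `R` from arc 0 to
arc 2 at mesh `δ`". [cite: Beffara2008Universal, §5.2] -/
theorem flip_real_pivotal (q : unitInterval) (S : Set (Set MixedSite)) (v : MixedSite) :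
    (prodBernoulli (mixedParam (unitInterval.symm q))).real {ω | insert v ω ∈ S ∧ ω \ {v} ∉ S} =
      (prodBernoulli (mixedParam q)).real
        {ω | insert v ω ∈ {ω' : Set MixedSite | ω'ᶜ ∉ S} ∧ ω \ {v} ∉ {ω' : Set MixedSite | ω'ᶜ ∉ S}} := by
  rw [flip_prodBernoulli_real, compl_preimage_pivotal]

/-- **Stub C1 of line `registered` (`stub_flipPairing`, registered signature verbatim): Beffara's
colour-flip pairing for the crude crossing of a conformal rectangle.**  For every `q`, `R`, `δ`, `f`,
the `P_{1/2,1-q}`-probability that the centre `inr f` is pivotal for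
`cross_δ(R) = siteEmbDomainCrossing unionJackGraph unionJackEmbed R.carrier δ (R.arc 0) (R.arc 2)` equals
the `P_{1/2,q}`-probability that `inr f` is pivotal for the flip-dual event `{ω | ωᶜ ∉ cross_δ(R)}`
(an instance of `flip_real_pivotal`). [cite: Beffara2008Universal, §5.2] -/
theorem stub_flipPairing :
    ∀ (q : unitInterval) (R : Literature.Probability.RandomPlanarGeometry.ConformalRectangle) (δ : ℝ) (f : ℤ × ℤ),
      (prodBernoulli (mixedParam (unitInterval.symm q))).real
          {ω | insert (Sum.inr f) ω ∈
                siteEmbDomainCrossing unionJackGraph unionJackEmbed R.carrier δ (R.arc 0) (R.arc 2) ∧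
              ω \ {Sum.inr f} ∉
                siteEmbDomainCrossing unionJackGraph unionJackEmbed R.carrier δ (R.arc 0) (R.arc 2)} =
        (prodBernoulli (mixedParam q)).real
          {ω | insert (Sum.inr f) ω ∈
                {ω' : Set Literature.Barriers.CriticalPhenomena.MixedSite |
                  ω'ᶜ ∉ siteEmbDomainCrossing unionJackGraph unionJackEmbed R.carrier δ (R.arc 0) (R.arc 2)} ∧
              ω \ {Sum.inr f} ∉
                {ω' : Set Literature.Barriers.CriticalPhenomena.MixedSite |
                  ω'ᶜ ∉ siteEmbDomainCrossing unionJackGraph unionJackEmbed R.carrier δ (R.arc 0) (R.arc 2)}} :=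
  fun q _ _ f => flip_real_pivotal q _ (Sum.inr f)

end Summit.CriticalPhenomena.CardyFormulaZ2.Cruxes.MixedInterpolation.Registered

end
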